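import Summits.ABC.ABC.Theorems.SoloBlindPolyABC
import HarnessLib

/-!
# The largest prime factor of `n(n+1)` under a polynomial abc inequality (solo-ABC-blind, generation 4)

The simplest slice of the `ρ₁` family of `SoloBlindCycloRad` (`(u, v) = (n, n+1)`, triple `1 + n = n+1`):
a polynomial abc inequality `PolyABC K` (`c ≤ C · rad(abc)^K`) forces the largest prime factor
`P(n(n+1))` to satisfy `log(n+1) ≤ K log 4 · P(n(n+1)) + log C`, i.e. `P(n(n+1)) ≥ (1/(K log 4) − o(1)) log n`
(`largePrimeFactor_consecutive_of_polyABC`; under `ABC`, with `K = 1 + ε`: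
`largePrimeFactor_consecutive_of_abc`).  The only input besides `PolyABC` is Chebyshev's bound
`∏_{p ≤ P} p ≤ 4^P` (`primorial_le_four_pow`), through `radical_le_four_pow_sup_primeFactors`.

For the wall: unconditionally the largest prime factor of a product of two consecutive integers (or of
`n² + 1`) is known to exceed only a power of `log log n` — the gap to `log n` is the same exponential gap
"known bounds are exponential in the radical" seen on the family `(1, n, n+1)`.  Here `P(m)` is coded as
`m.primeFactors.sup id`.
-/

open UniqueFactorizationMonoid Finset

namespace Summit.ABC.ABC.Theorems

open Literature.NumberTheory.DiophantineGeometry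

/-- `rad m ≤ 4 ^ P(m)` with `P(m) = m.primeFactors.sup id` the largest prime factor: the radical divides
the primorial of `P(m)`, which is at most `4 ^ P(m)` (Chebyshev). [folklore] -/
theorem radical_le_four_pow_sup_primeFactors (m : ℕ) :
    radical m ≤ 4 ^ (m.primeFactors.sup id) := by
  rcases eq_or_ne m 0 with rfl | hm
  · simp [radical_zero]
  rw [Nat.radical_eq_prod_primeFactors]
  set P := m.primeFactors.sup id with hP
  have hsub : m.primeFactors ⊆ (Finset.range (P + 1)).filter Nat.Prime := by
    intro p hp
    rw [Finset.mem_filter, Finset.mem_range]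
    refine ⟨Nat.lt_succ_of_le ?_, Nat.prime_of_mem_primeFactors hp⟩
    exact Finset.le_sup (f := id) hp
  have h1 : ∏ p ∈ m.primeFactors, p ∣ primorial P := by
    unfold primorial
    exact Finset.prod_dvd_prod_of_subset _ _ (fun p => p) hsub
  exact (Nat.le_of_dvd (primorial_pos _) h1).trans (primorial_le_four_pow P)

/-- **`PolyABC K` bounds the largest prime factor of `n(n+1)` from below by `log n`:** there is `A`
with `log(n+1) ≤ K · log 4 · P(n(n+1)) + A` for all `n ≥ 1`. [folklore] -/
theorem largePrimeFactor_consecutive_of_polyABC {K : ℝ} (hP : PolyABC K) :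
    ∃ A : ℝ, ∀ n : ℕ, 1 ≤ n →
      Real.log ((n : ℝ) + 1) ≤ K * Real.log 4 * (((n * (n + 1)).primeFactors.sup id : ℕ) : ℝ) + A := by
  have hK := polyABC_pos hP
  obtain ⟨C, hC, HC⟩ := hP
  refine ⟨Real.log C, fun n hn => ?_⟩
  have habc : IsABCTriple 1 n (n + 1) := ⟨Nat.one_pos, by omega, by omega, Nat.coprime_one_left _⟩
  have h1 := HC 1 n (n + 1) habc
  have hrad : (rad 1 n (n + 1) : ℕ) = radical (n * (n + 1)) := by rw [rad_def, one_mul]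
  set P : ℕ := (n * (n + 1)).primeFactors.sup id with hPdef
  have h2 : ((rad 1 n (n + 1) : ℕ) : ℝ) ≤ (4 : ℝ) ^ (P : ℝ) := by
    rw [hrad, Real.rpow_natCast]
    exact_mod_cast radical_le_four_pow_sup_primeFactors (n * (n + 1))
  have hR0 : (0 : ℝ) < ((rad 1 n (n + 1) : ℕ) : ℝ) := rad_cast_pos habc
  have h3 : ((n : ℝ) + 1) ≤ C * ((4 : ℝ) ^ (P : ℝ)) ^ K := by
    have h1' : (((n + 1 : ℕ) : ℝ)) ≤ C * ((rad 1 n (n + 1) : ℕ) : ℝ) ^ K := h1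
    push_cast at h1'
    exact h1'.trans (mul_le_mul_of_nonneg_left (Real.rpow_le_rpow hR0.le h2 hK.le) hC.le)
  have hpos : (0 : ℝ) < (n : ℝ) + 1 := by positivity
  have h4 := Real.log_le_log hpos h3
  rw [Real.log_mul hC.ne' (by positivity), ← Real.rpow_mul (by norm_num),
    Real.log_rpow (by norm_num)] at h4
  -- h4 : log (n+1) ≤ log C + P * K * log 4
  linarith

/-- **Under `ABC`:** for every `ε > 0` there is `A` with `log(n+1) ≤ (1+ε) · log 4 · P(n(n+1)) + A` for all
`n ≥ 1`. [folklore] -/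
theorem largePrimeFactor_consecutive_of_abc (habc : ABC) {ε : ℝ} (hε : 0 < ε) :
    ∃ A : ℝ, ∀ n : ℕ, 1 ≤ n →
      Real.log ((n : ℝ) + 1) ≤ (1 + ε) * Real.log 4 * (((n * (n + 1)).primeFactors.sup id : ℕ) : ℝ) + A :=
  largePrimeFactor_consecutive_of_polyABC (polyABC_of_abc habc (by linarith))

end Summit.ABC.ABC.Theorems
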